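import Literature.Analysis.Complex.GraphContourDeformationFirstCoord
import Mathlib.Analysis.InnerProductSpace.Projection.Reflection
import Mathlib.Topology.Algebra.Module.FiniteDimension
import HarnessLib

/-!
# Deformation of `ℝ^{n+1}` into a graph along an arbitrary direction

Topic `Literature/Analysis/Complex`. The rotation step completing
`GraphContourDeformationFirstCoord.lean`: for `Ψ` holomorphic on an open `U ⊆ ℂ^{n+1}`, a
direction `v ∈ ℝ^{n+1}`, `φ : ℝ^{n+1} → ℝ` of class `C¹` with compact support, and the graphs
`cx w + iθφ(w)v`, `0 ≤ θ ≤ 1`, inside `U`,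

  `∫ w, (1 + i ∂ᵥφ(w)) • Ψ(cx w + iφ(w)v) = ∫ w, Ψ(cx w)`

(`integral_graph_deformation_direction_eq`). A linear isometry `Q` of `ℝ^{n+1}` with
`Q e₀ = v/‖v‖` (the reflection exchanging the two unit vectors, Mathlib
`Submodule.reflection_sub`) and its complexification `Q_ℂ` (a `ℂ`-linear map of `ℂ^{n+1}` with
`Q_ℂ(cx a + i cx b) = cx(Qa) + i cx(Qb)`) transport the statement to the first-coordinate case
(`integral_graph_deformation_firstCoord_eq`); Lebesgue measure is invariant under `Q`
(`LinearIsometryEquiv.measurePreserving`). This is the form used to continue space potentials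
`∫ K(z - w) a(w) dw` analytically: the contour is pushed in the direction `Im z`.

## References

* Z. Grujić, I. Kukavica, J. Funct. Anal. 152 (1998) 447–466, §2. [GrujicKukavica1998]
* Z. Bradshaw, Z. Grujić, I. Kukavica, J. Differential Equations 259 (2015), §3.
  [BradshawGrujicKukavica2015]
-/

noncomputable section

open MeasureTheory Set Function Filter Metric
open _root_.Topology
open _root_.Complex (I)
open Literature.Analysis.FunctionSpaces.EuclideanSpace (complexify complexify_apply)

namespace Literature.Analysis.Complex

variable {G : Type*} [NormedAddCommGroup G] [NormedSpace ℂ G] [CompleteSpace G]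
variable {ι : Type*} [Fintype ι]

/-! ### Real and imaginary parts of complex vectors; complexification of a real linear map -/

omit [Fintype ι] in
/-- Real parts of a complex vector. (Inline: `WithLp.toLp 2 fun i => (ζ i).re`.) Coordinates.
[folklore] -/
theorem toLp_re_apply (ζ : EuclideanSpace ℂ ι) (i : ι) :
    (WithLp.toLp 2 (fun i => (ζ i).re) : EuclideanSpace ℝ ι) i = (ζ i).re := rfl

/-- Every complex vector is `cx (Re ζ) + i cx (Im ζ)`. [folklore] -/
theorem complexify_re_add_I_smul_complexify_im (ζ : EuclideanSpace ℂ ι) :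
    complexify (WithLp.toLp 2 (fun i => (ζ i).re) : EuclideanSpace ℝ ι) +
        I • complexify (WithLp.toLp 2 (fun i => (ζ i).im) : EuclideanSpace ℝ ι) = ζ := by
  ext i
  simp [complexify_apply, mul_comm I, Complex.re_add_im]

/-- **The complexification of a real linear map is `ℂ`-linear.** For a real linear map `Q` of
`ℝ^ι`, the map `ζ ↦ cx (Q (Re ζ)) + i cx (Q (Im ζ))` of `ℂ^ι` is `ℂ`-linear. [folklore] -/
theorem isLinearMap_complexification (Q : EuclideanSpace ℝ ι →ₗ[ℝ] EuclideanSpace ℝ ι) :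
    IsLinearMap ℂ fun ζ : EuclideanSpace ℂ ι =>
      complexify (Q (WithLp.toLp 2 (fun i => (ζ i).re) : EuclideanSpace ℝ ι)) +
        I • complexify (Q (WithLp.toLp 2 (fun i => (ζ i).im) : EuclideanSpace ℝ ι)) := by
  constructor
  · intro ζ ξ
    have hre : (WithLp.toLp 2 (fun i => ((ζ + ξ) i).re) : EuclideanSpace ℝ ι) =
        (WithLp.toLp 2 (fun i => (ζ i).re) : EuclideanSpace ℝ ι) +
          (WithLp.toLp 2 (fun i => (ξ i).re) : EuclideanSpace ℝ ι) := by
      ext i; simp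
    have him : (WithLp.toLp 2 (fun i => ((ζ + ξ) i).im) : EuclideanSpace ℝ ι) =
        (WithLp.toLp 2 (fun i => (ζ i).im) : EuclideanSpace ℝ ι) +
          (WithLp.toLp 2 (fun i => (ξ i).im) : EuclideanSpace ℝ ι) := by
      ext i; simp
    rw [hre, him, map_add, map_add, map_add, map_add, smul_add]
    abel
  · intro c ζ
    have hre : (WithLp.toLp 2 (fun i => ((c • ζ) i).re) : EuclideanSpace ℝ ι) =
        c.re • (WithLp.toLp 2 (fun i => (ζ i).re) : EuclideanSpace ℝ ι) -
          c.im • (WithLp.toLp 2 (fun i => (ζ i).im) : EuclideanSpace ℝ ι) := by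
      ext i; simp [Complex.mul_re]
    have him : (WithLp.toLp 2 (fun i => ((c • ζ) i).im) : EuclideanSpace ℝ ι) =
        c.re • (WithLp.toLp 2 (fun i => (ζ i).im) : EuclideanSpace ℝ ι) +
          c.im • (WithLp.toLp 2 (fun i => (ζ i).re) : EuclideanSpace ℝ ι) := by
      ext i; simp [Complex.mul_im]
    rw [hre, him, map_sub, map_add, map_smul, map_smul, map_smul, map_smul]
    ext i
    simp only [PiLp.add_apply, PiLp.smul_apply, PiLp.sub_apply, map_sub, map_add,
      LinearIsometry.map_smul, complexify_apply, smul_eq_mul, Complex.real_smul]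
    apply Complex.ext <;> simp [Complex.mul_re, Complex.mul_im]

/-- The complexification fixes the form `cx a + i cx b`: it maps it to `cx (Q a) + i cx (Q b)`.
[folklore] -/
theorem complexification_complexify_add_I_smul (Q : EuclideanSpace ℝ ι →ₗ[ℝ] EuclideanSpace ℝ ι)
    (a b : EuclideanSpace ℝ ι) :
    (fun ζ : EuclideanSpace ℂ ι =>
      complexify (Q (WithLp.toLp 2 (fun i => (ζ i).re) : EuclideanSpace ℝ ι)) +
        I • complexify (Q (WithLp.toLp 2 (fun i => (ζ i).im) : EuclideanSpace ℝ ι)))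
      (complexify a + I • complexify b) = complexify (Q a) + I • complexify (Q b) := by
  have hre : (WithLp.toLp 2 (fun i => ((complexify a + I • complexify b) i).re) :
      EuclideanSpace ℝ ι) = a := by
    ext i; simp [complexify_apply]
  have him : (WithLp.toLp 2 (fun i => ((complexify a + I • complexify b) i).im) :
      EuclideanSpace ℝ ι) = b := by
    ext i; simp [complexify_apply]
  simp only [hre, him]

/-! ### The deformation theorem in an arbitrary direction -/

/-- **Deformation of `ℝ^{n+1}` into a graph along the direction `v`.** Let `Ψ : ℂ^{n+1} → G` be
holomorphic on an open `U`, `v ∈ ℝ^{n+1}`, `φ : ℝ^{n+1} → ℝ` of class `C¹` with compact support,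
and assume the graphs `cx w + iθφ(w)v`, `0 ≤ θ ≤ 1`, lie in `U`. If both integrands are
integrable, then `∫ w, (1 + i ∂ᵥφ(w)) • Ψ(cx w + iφ(w)v) = ∫ w, Ψ(cx w)`. [folklore] -/
theorem integral_graph_deformation_direction_eq {n : ℕ}
    {Ψ : EuclideanSpace ℂ (Fin (n + 1)) → G} {U : Set (EuclideanSpace ℂ (Fin (n + 1)))}
    (hU : IsOpen U) (hΨ : DifferentiableOn ℂ Ψ U) (v : EuclideanSpace ℝ (Fin (n + 1)))
    {φ : EuclideanSpace ℝ (Fin (n + 1)) → ℝ} (hφ : ContDiff ℝ 1 φ) (hφc : HasCompactSupport φ)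
    (hsweep : ∀ w : EuclideanSpace ℝ (Fin (n + 1)), ∀ θ ∈ Icc (0 : ℝ) 1,
      complexify w + I • complexify ((θ * φ w) • v) ∈ U)
    (hintL : Integrable fun w : EuclideanSpace ℝ (Fin (n + 1)) =>
      ((1 : ℂ) + I * ((fderiv ℝ φ w v : ℝ) : ℂ)) • Ψ (complexify w + I • complexify (φ w • v)))
    (hintR : Integrable fun w : EuclideanSpace ℝ (Fin (n + 1)) => Ψ (complexify w)) :
    ∫ w : EuclideanSpace ℝ (Fin (n + 1)),
        ((1 : ℂ) + I * ((fderiv ℝ φ w v : ℝ) : ℂ)) • Ψ (complexify w + I • complexify (φ w • v)) =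
      ∫ w : EuclideanSpace ℝ (Fin (n + 1)), Ψ (complexify w) := by
  rcases eq_or_ne v 0 with rfl | hv
  · refine integral_congr_ae (Eventually.of_forall fun w => ?_)
    simp
  set Lf : EuclideanSpace ℝ (Fin (n + 1)) → G := fun w =>
    ((1 : ℂ) + I * ((fderiv ℝ φ w v : ℝ) : ℂ)) •
      Ψ (complexify w + I • complexify (φ w • v)) with hLf
  set Rf : EuclideanSpace ℝ (Fin (n + 1)) → G := fun w => Ψ (complexify w) with hRf
  -- the unit vector `u = v/‖v‖` and an isometry `Q` with `Q e₀ = u`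
  have hvn : 0 < ‖v‖ := norm_pos_iff.2 hv
  set u : EuclideanSpace ℝ (Fin (n + 1)) := ‖v‖⁻¹ • v with hu
  have hun : ‖u‖ = 1 := by
    rw [hu, norm_smul, norm_inv, norm_norm, inv_mul_cancel₀ hvn.ne']
  set e₀ : EuclideanSpace ℝ (Fin (n + 1)) := EuclideanSpace.single 0 1 with he₀
  have he₀n : ‖e₀‖ = 1 := by
    rw [he₀]
    exact (PiLp.norm_single 2 (fun _ : Fin (n + 1) => ℝ) 0 (1 : ℝ)).trans norm_one
  set Q : EuclideanSpace ℝ (Fin (n + 1)) ≃ₗᵢ[ℝ] EuclideanSpace ℝ (Fin (n + 1)) :=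
    (ℝ ∙ (e₀ - u))ᗮ.reflection with hQdef
  have hQe : Q e₀ = u := Submodule.reflection_sub (by rw [he₀n, hun])
  have hvu : ‖v‖ • u = v := by rw [hu, smul_smul, mul_inv_cancel₀ hvn.ne', one_smul]
  -- the complexification of `Q`
  set QC : EuclideanSpace ℂ (Fin (n + 1)) → EuclideanSpace ℂ (Fin (n + 1)) := fun ζ =>
    complexify (Q.toLinearEquiv.toLinearMap
      (WithLp.toLp 2 (fun i => (ζ i).re) : EuclideanSpace ℝ (Fin (n + 1)))) +
      I • complexify (Q.toLinearEquiv.toLinearMap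
        (WithLp.toLp 2 (fun i => (ζ i).im) : EuclideanSpace ℝ (Fin (n + 1)))) with hQC
  have hQClin : IsLinearMap ℂ QC := isLinearMap_complexification Q.toLinearEquiv.toLinearMap
  have hQCcont : Continuous QC := by
    have : QC = (hQClin.mk' :
        EuclideanSpace ℂ (Fin (n + 1)) →ₗ[ℂ] EuclideanSpace ℂ (Fin (n + 1))) := rfl
    rw [this]
    exact LinearMap.continuous_of_finiteDimensional _
  have hQCdiff : Differentiable ℂ QC := by
    have : QC = ((hQClin.mk' : EuclideanSpace ℂ (Fin (n + 1)) →ₗ[ℂ]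
        EuclideanSpace ℂ (Fin (n + 1))).toContinuousLinearMap :
          EuclideanSpace ℂ (Fin (n + 1)) →L[ℂ] EuclideanSpace ℂ (Fin (n + 1))) := rfl
    rw [this]
    exact ContinuousLinearMap.differentiable _
  have hQCpt : ∀ a b : EuclideanSpace ℝ (Fin (n + 1)),
      QC (complexify a + I • complexify b) = complexify (Q a) + I • complexify (Q b) :=
    fun a b => complexification_complexify_add_I_smul Q.toLinearEquiv.toLinearMap a b
  have hQCreal : ∀ a : EuclideanSpace ℝ (Fin (n + 1)), QC (complexify a) = complexify (Q a) := by
    intro a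
    have h := hQCpt a 0
    simpa using h
  -- transported data
  set Ψ' : EuclideanSpace ℂ (Fin (n + 1)) → G := Ψ ∘ QC with hΨ'
  set U' : Set (EuclideanSpace ℂ (Fin (n + 1))) := QC ⁻¹' U with hU'
  set φ' : EuclideanSpace ℝ (Fin (n + 1)) → ℝ := fun w => ‖v‖ * φ (Q w) with hφ'
  have hU'open : IsOpen U' := hU.preimage hQCcont
  have hΨ'diff : DifferentiableOn ℂ Ψ' U' := hΨ.comp hQCdiff.differentiableOn fun ζ hζ => hζ
  have hQcont : ContDiff ℝ 1 (fun w => Q w) := Q.toContinuousLinearEquiv.contDiff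
  have hQd : ∀ w, DifferentiableAt ℝ (fun w => Q w) w := fun w =>
    Q.toContinuousLinearEquiv.differentiableAt
  have hQfd : ∀ w, fderiv ℝ (fun w => Q w) w =
      (Q.toContinuousLinearEquiv : EuclideanSpace ℝ (Fin (n + 1)) →L[ℝ] _) := fun w =>
    Q.toContinuousLinearEquiv.fderiv
  have hφ'C : ContDiff ℝ 1 φ' := contDiff_const.mul (hφ.comp hQcont)
  have hφ'c : HasCompactSupport φ' := (hφc.comp_homeomorph Q.toHomeomorph).mul_left
  -- the key pointwise identities
  have hpt : ∀ (w : EuclideanSpace ℝ (Fin (n + 1))) (s : ℝ),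
      QC (complexify w + I • complexify ((s * φ' w) • e₀)) =
        complexify (Q w) + I • complexify ((s * φ (Q w)) • v) := by
    intro w s
    rw [hQCpt, LinearIsometryEquiv.map_smul, hQe, hφ', hu, smul_smul]
    congr 3
    field_simp
  have hderiv : ∀ w : EuclideanSpace ℝ (Fin (n + 1)),
      fderiv ℝ φ' w e₀ = fderiv ℝ φ (Q w) v := by
    intro w
    have hd : DifferentiableAt ℝ φ (Q w) := (hφ.differentiable (by simp)) _
    have h1 : fderiv ℝ (fun w => φ (Q w)) w = (fderiv ℝ φ (Q w)).comp
        (Q.toContinuousLinearEquiv : EuclideanSpace ℝ (Fin (n + 1)) →L[ℝ] _) := by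
      rw [← hQfd w]
      exact fderiv_comp w hd (hQd w)
    have h2 : fderiv ℝ φ' w = ‖v‖ • fderiv ℝ (fun w => φ (Q w)) w := by
      rw [hφ', show (fun w => ‖v‖ * φ (Q w)) = fun w => ‖v‖ • φ (Q w) from rfl]
      exact fderiv_const_smul (hd.comp w (hQd w)) ‖v‖
    rw [h2, FunLike.coe_smul, Pi.smul_apply, h1, ContinuousLinearMap.comp_apply, smul_eq_mul]
    change ‖v‖ * fderiv ℝ φ (Q w) (Q e₀) = _
    rw [hQe, ← smul_eq_mul, ← ContinuousLinearMap.map_smul, hvu]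
  -- hypotheses of the first-coordinate theorem
  have hsweep' : ∀ w : EuclideanSpace ℝ (Fin (n + 1)), ∀ θ ∈ Icc (0 : ℝ) 1,
      complexify w + I • complexify ((θ * φ' w) • e₀) ∈ U' := by
    intro w θ hθ
    show QC _ ∈ U
    rw [hpt]
    exact hsweep (Q w) θ hθ
  have hmp : MeasurePreserving (fun w => Q w) volume volume := Q.measurePreserving
  have hQemb : MeasurableEmbedding fun w => Q w := Q.toHomeomorph.measurableEmbedding
  have hLcomp : (fun w : EuclideanSpace ℝ (Fin (n + 1)) =>
      ((1 : ℂ) + I * ((fderiv ℝ φ' w e₀ : ℝ) : ℂ)) •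
        Ψ' (complexify w + I • complexify (φ' w • e₀))) = Lf ∘ fun w => Q w := by
    funext w
    simp only [Function.comp_apply, hΨ', hderiv, hLf]
    congr 2
    have h := hpt w 1
    rw [one_mul, one_mul] at h
    exact h
  have hRcomp : (fun w : EuclideanSpace ℝ (Fin (n + 1)) => Ψ' (complexify w)) =
      Rf ∘ fun w => Q w := by
    funext w
    simp only [Function.comp_apply, hΨ', hQCreal, hRf]
  have hintL' : Integrable fun w : EuclideanSpace ℝ (Fin (n + 1)) =>
      ((1 : ℂ) + I * ((fderiv ℝ φ' w e₀ : ℝ) : ℂ)) •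
        Ψ' (complexify w + I • complexify (φ' w • e₀)) := by
    rw [hLcomp]
    exact (hmp.integrable_comp_emb hQemb).2 hintL
  have hintR' : Integrable fun w : EuclideanSpace ℝ (Fin (n + 1)) => Ψ' (complexify w) := by
    rw [hRcomp]
    exact (hmp.integrable_comp_emb hQemb).2 hintR
  have key := integral_graph_deformation_firstCoord_eq hU'open hΨ'diff hφ'C hφ'c hsweep'
    hintL' hintR'
  rw [hLcomp, hRcomp] at key
  have eL : ∫ w, (Lf ∘ fun w => Q w) w = ∫ w, Lf w := hmp.integral_comp hQemb Lf
  have eR : ∫ w, (Rf ∘ fun w => Q w) w = ∫ w, Rf w := hmp.integral_comp hQemb Rf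
  rw [eL, eR] at key
  exact key

end Literature.Analysis.Complex

end
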